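import Summits.BirchSwinnertonDyer.BirchSwinnertonDyer.Theorems.GenusKolyvaginAtTwoGenusPrimitiveSupplyAtTwoArchimedeanTwist
import Summits.BirchSwinnertonDyer.BirchSwinnertonDyer.Theorems.GenusKolyvaginAtTwoGenusPrimitiveSupplyAtTwoArchimedeanTransverse
import Summits.BirchSwinnertonDyer.BirchSwinnertonDyer.Theorems.GenusKolyvaginAtTwoGenusPrimitiveSupplyAtTwoTwistLocalConditionFrame
import Summits.BirchSwinnertonDyer.BirchSwinnertonDyer.Theorems.GenusKolyvaginAtTwoKramerParityOfFrame
import HarnessLib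

/-!
# Route `GenusKolyvaginAtTwo`, crux #2 `GenusPrimitiveSupplyAtTwo` (stmt-BirchSwinnertonDyer-22136):
# Mazur–Rubin Cor. 3.4 (i) with a single REAL `T`-place for the CANONICAL identification — UP and the T-A dichotomy WITHOUT
# Kramer parity as a named fact and WITHOUT the `ρ̄_{W,2}`-onto hypothesis (every number field)

Width seat `bsd-line-gk2-p4` g12 (cell `bsd-f1-sign2`), sequel of gk2-p5's files 21/23/24 (`…ArchimedeanTwist`, `…ArchimedeanTransverse`,
`…ArchimedeanCapstone`) and of the KramerParity series part 9 (`GenusKolyKramer.isSquare_card_selmerGroup_mul_of_frame`: Kramer's congruence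
for every FRAMED identification, all inputs tree theorems) and `…TwistLocalConditionFrame` (the canonical identification IS framed).
THEOREMS ONLY (no definition, no named fact, no `sorry`); helper `--supports stmt-BirchSwinnertonDyer-22136`; no item is closed; BSD is not
proved by any of this.

WHAT. gk2-p5's UP theorem `natCard_selmerGroup_twist_eq_mul_two_of_places_inl_of_parity` displays `hKP : MazurRubin2010.kramerParity K` and
`hsurj : ρ̄_{W,2} onto` — the latter ONLY to produce the binder `huniq` of the former. With the `huniq`-free congruence of part 9 both go:

* §70 `exists_intertwining_hsplit_and_transverse_inl_frame` — file 23's package (ONE pair of inverse intertwinings `φ : Wd[2] ≅ W[2] : φ'`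
  agreeing with the Kummer conditions at split places and transverse at the real places `w(Δ_W) > 0` where `d` is a non-square) PLUS the
  frame datum of the same `φ` (`φ T'_j = T_{πj}`, `x'_i − x'_j = A·(x_{πi} − x_{πj})`);
* §71 `natCard_selmerGroup_twist_eq_mul_two_of_places_inl_of_frame` (UP: `Sel₂(W)` strict at `w₀` ⟹ `#Sel₂(Wd) = #Sel₂(W)·2`) and
  `natCard_selmerGroup_twist_shift_of_places_inl_of_frame` (the dichotomy), for a FRAMED `φ`, modulo {PT, Tate χ} displayed as in file 21 —
  no parity fact, no image hypothesis, no «`d` non-square in `K`»;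
* §72 **`natCard_selmerGroup_twist_shift_of_places_inl_frame`** — the dichotomy from the place menus ALONE (PT and Tate χ fed by
  `poitouTate_selmerStructure_duality_real_holds` / `localEulerPoincareCharacteristic_holds`): `#Sel₂(Wd)·2 = #Sel₂(W) ∨ #Sel₂(Wd) = #Sel₂(W)·2`
  for every twist model `C • W^{(d)} = Wd`, real `w₀` with `w₀(Δ_W) > 0` and `d ∉ K_{w₀}²`, finite places on {split | odd good both |
  odd silent both}, other infinite places on {split | H¹ = 0 both} — UNCONDITIONAL. The cell's T-A / T-A′ / T-C / T-V rows BY NAME follow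
  over `ℚ` (sequel file `…ArchimedeanRowsHold`).

References: [MazurRubin2010] Thm. 2.7, Remark 2.4, Lemmas 2.9–2.10, Prop. 3.3, Cor. 3.4 (i); [Kramer1981] §2 Prop. 6, Thm. 1;
[KlagsbrunMazurRubin2013] Thm. 3.9, Lemma 5.2; [MilneADT2006] I Thm. 2.8, 2.13, 4.10.
-/

set_option linter.dupNamespace false -- tree convention: `Summit.BirchSwinnertonDyer.BirchSwinnertonDyer.Theorems` (summit = sub-problem)
set_option autoImplicit false

noncomputable section

open scoped Classical ContRepresentation

namespace Summit.BirchSwinnertonDyer.BirchSwinnertonDyer.Theorems.GenusKolyArch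

open WeierstrassCurve Field NumberField IsDedekindDomain Function
open Literature.NumberTheory.EllipticCurves Literature.NumberTheory.GaloisRepresentations
open Literature.NumberTheory.EllipticCurves.DokchitserDokchitser2012 (T xT)
open Literature.NumberTheory.GaloisRepresentations.DiscreteGaloisModule (SelmerStructure)
open Literature.NumberTheory.GaloisCohomology
open Summit.BirchSwinnertonDyer.Rank1Residual.X11b.CongruentTransfer
open Summit.BirchSwinnertonDyer.BirchSwinnertonDyer.Theorems.GenusKolyTwistLocal
open Summit.BirchSwinnertonDyer.BirchSwinnertonDyer.Theorems.SchneiderFreeAdditiveX3.PoitouTateReduction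
  (poitouTate_selmerStructure_duality_real_holds)

variable {K : Type} [Field K] [NumberField K] (W : WeierstrassCurve K) [W.IsElliptic]

/-! ## §70 The canonical identification: split agreement, real transversality AND the frame datum -/

/-- **The canonical identification `E^{(d)}[2] ≅ E[2]` with its three properties at once**: agreement with the Kummer conditions at every
`K`-field where `d` is a square (Lemma 2.10 (i)), transversality at every real place `w` with `w(Δ_E) > 0` where `d` is not a square
(Lemma 2.9 at `v ∣ ∞` / Kramer Prop. 6), and the FRAME DATUM (`φ T'_j = T_{πj}`, affinely related abscissae) — one pair of inverse
intertwinings for all three. File 23's proof verbatim on top of `exists_addEquiv_geomTorsion_two_localSquare_signed_frame`.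
[cite: MazurRubin2010, Remark 2.4, Lemma 2.9, Lemma 2.10 (i)] [cite: Kramer1981, §2 Prop. 6 (p. 127)] [cite: KlagsbrunMazurRubin2013, Lemma 5.2] -/
theorem exists_intertwining_hsplit_and_transverse_inl_frame {d : K} (hd : d ≠ 0) {Wd : WeierstrassCurve K} [Wd.IsElliptic]
    {C : VariableChange K} (hWd : C • W.quadraticTwist d = Wd) :
    ∃ (φ : (Wd.torsionGaloisModule ((2 : ℕ) : ℤ)).toContRepresentation →ⁱL
        (W.torsionGaloisModule ((2 : ℕ) : ℤ)).toContRepresentation)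
      (φ' : (W.torsionGaloisModule ((2 : ℕ) : ℤ)).toContRepresentation →ⁱL
        (Wd.torsionGaloisModule ((2 : ℕ) : ℤ)).toContRepresentation),
      (∀ a, φ' (φ a) = a) ∧ (∀ b, φ (φ' b) = b) ∧
      (∀ (E : Type) [Field E] [Algebra K E], (∃ s : E, s ^ 2 = algebraMap K E d) →
        (Wd.kummerLocalConditionAt ((2 : ℕ) : ℤ) E).map (galoisCohomology.map (φ.restrictField E) 1) =
          W.kummerLocalConditionAt ((2 : ℕ) : ℤ) E) ∧
      (∀ (w : InfinitePlace K) (hw : w.IsReal), 0 < InfinitePlace.embedding_of_isReal hw W.Δ →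
        (∀ s : w.Completion, s ^ 2 ≠ algebraMap K w.Completion d) →
        (Wd.kummerLocalConditionAt ((2 : ℕ) : ℤ) w.Completion).map
            (galoisCohomology.map (φ.restrictField w.Completion) 1) ⊓
          W.kummerLocalConditionAt ((2 : ℕ) : ℤ) w.Completion = ⊥) ∧
      ∃ (π : Fin 3 → Fin 3) (A : K),
        (∀ j, (show (Wd.torsionGaloisModule 2).toContRepresentation →ⁱL (W.torsionGaloisModule 2).toContRepresentation
          from φ) (T Wd (two_ne_zero (α := K)) j) = T W (two_ne_zero (α := K)) (π j)) ∧
        (∀ i j, xT Wd (two_ne_zero (α := K)) i - xT Wd (two_ne_zero (α := K)) j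
          = algebraMap K (AlgebraicClosure K) A
            * (xT W (two_ne_zero (α := K)) (π i) - xT W (two_ne_zero (α := K)) (π j))) := by
  haveI : NeZero (2 : K) := ⟨two_ne_zero⟩
  obtain ⟨ψ, hψ, ⟨π, A, hπ, hA⟩, hloc⟩ := exists_addEquiv_geomTorsion_two_localSquare_signed_frame W hd hWd
  have hψ' : ∀ (σ : absoluteGaloisGroup K) (Q : geomTorsion W (2 : ℤ)),
      ψ.symm (σ • Q) = σ • ψ.symm Q := fun σ Q ↦
    ψ.injective (by rw [hψ, ψ.apply_symm_apply, ψ.apply_symm_apply])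
  let φ : (Wd.torsionGaloisModule ((2 : ℕ) : ℤ)).toContRepresentation →ⁱL
      (W.torsionGaloisModule ((2 : ℕ) : ℤ)).toContRepresentation :=
    { toContinuousLinearMap := ⟨ψ.toAddMonoidHom.toIntLinearMap, continuous_of_discreteTopology⟩
      isIntertwining' := fun σ ↦ by
        ext P
        exact congrArg Subtype.val (hψ σ P) }
  let φ' : (W.torsionGaloisModule ((2 : ℕ) : ℤ)).toContRepresentation →ⁱL
      (Wd.torsionGaloisModule ((2 : ℕ) : ℤ)).toContRepresentation :=
    { toContinuousLinearMap := ⟨ψ.symm.toAddMonoidHom.toIntLinearMap, continuous_of_discreteTopology⟩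
      isIntertwining' := fun σ ↦ by
        ext Q
        exact congrArg Subtype.val (hψ' σ Q) }
  have hφ : ∀ a, φ a = ψ a := fun _ ↦ rfl
  have hφ' : ∀ b, φ' b = ψ.symm b := fun _ ↦ rfl
  -- one inclusion of Lemma 2.10 (i), for an arbitrary `Γ_E`-equivariant intertwined datum (as in g8's files)
  have key : ∀ (E : Type) [Field E] [Algebra K E] {X Y : WeierstrassCurve K}
      (χ : (X.torsionGaloisModule ((2 : ℕ) : ℤ)).toContRepresentation →ⁱL
        (Y.torsionGaloisModule ((2 : ℕ) : ℤ)).toContRepresentation) (η : localPoints X E ≃+ localPoints Y E),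
      (∀ (σ : absoluteGaloisGroup E) (Q : localPoints X E), η (σ • Q) = σ • η Q) →
      (∀ t : geomTorsion X ((2 : ℕ) : ℤ),
        pointsMap Y E (χ t : geomPoints Y) = η (pointsMap X E (t : geomPoints X))) →
      ∀ x ∈ X.kummerLocalConditionAt ((2 : ℕ) : ℤ) E,
        galoisCohomology.map (χ.restrictField E) 1 x ∈ Y.kummerLocalConditionAt ((2 : ℕ) : ℤ) E := by
    intro E _ _ X Y χ η hη hχ x hx
    obtain ⟨f, rfl⟩ := oneCocycleClass_surjective
      (DiscreteGaloisModule.toTopRep (GaloisRep.restrictField E (X.torsionGaloisModule ((2 : ℕ) : ℤ)))) x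
    rw [mem_kummerLocalConditionAt_iff, map_torsionPointsMapIntertwining_oneCocycleClass] at hx
    obtain ⟨Q, hQ⟩ := (oneCocycleClass_eq_zero_iff _ _).mp hx
    have hQ' : ∀ σ : absoluteGaloisGroup E,
        pointsMap X E ((f.1 σ : geomTorsion X ((2 : ℕ) : ℤ)) : geomPoints X) = σ • Q - Q := hQ
    rw [galoisCohomology.map_one_oneCocycleClass, mem_kummerLocalConditionAt_iff,
      map_torsionPointsMapIntertwining_oneCocycleClass]
    refine (oneCocycleClass_eq_zero_iff _ _).mpr ⟨η Q, fun σ ↦ ?_⟩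
    change pointsMap Y E ((χ (f.1 σ) : geomTorsion Y ((2 : ℕ) : ℤ)) : geomPoints Y) = σ • η Q - η Q
    rw [hχ, hQ', map_sub, hη]
  refine ⟨φ, φ', fun a ↦ ψ.symm_apply_apply a, fun b ↦ ψ.apply_symm_apply b, fun E _ _ hsq ↦ ?_,
    fun w hw hΔ hdsq ↦ ?_, π, A, fun j ↦ hπ j, hA⟩
  · -- (i) split places: every `σ` fixes `ι(√d)`, `θ_E` is `Γ_E`-equivariant
    obtain ⟨s, hs⟩ := hsq
    obtain ⟨θ, hfix, -, -, hsquare⟩ := hloc E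
    have hθ : ∀ (σ : absoluteGaloisGroup E) (Q : localPoints Wd E), θ (σ • Q) = σ • θ Q :=
      fun σ Q ↦ hfix σ (smul_closureEmb_geomSqrt_eq E hs σ) Q
    have hθ' : ∀ (σ : absoluteGaloisGroup E) (Q : localPoints W E), θ.symm (σ • Q) = σ • θ.symm Q :=
      symm_equivariant θ hθ
    have hsquare' : ∀ t : geomTorsion W ((2 : ℕ) : ℤ),
        pointsMap Wd E (ψ.symm t : geomPoints Wd) = θ.symm (pointsMap W E (t : geomPoints W)) := fun t ↦ by
      apply θ.injective
      rw [← hsquare (ψ.symm t), ψ.apply_symm_apply, θ.apply_symm_apply]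
    apply le_antisymm
    · rw [AddSubgroup.map_le_iff_le_comap]
      intro x hx
      exact key E φ θ hθ (fun t ↦ by rw [hφ]; exact hsquare t) x hx
    · intro y hy
      refine ⟨galoisCohomology.map (φ'.restrictField E) 1 y,
        key E φ' θ.symm hθ' (fun t ↦ by rw [hφ']; exact hsquare' t) y hy, ?_⟩
      obtain ⟨f, rfl⟩ := oneCocycleClass_surjective
        (DiscreteGaloisModule.toTopRep (GaloisRep.restrictField E (W.torsionGaloisModule ((2 : ℕ) : ℤ)))) y
      rw [galoisCohomology.map_one_oneCocycleClass, galoisCohomology.map_one_oneCocycleClass]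
      congr 1
      apply Subtype.ext
      ext g : 1
      rw [contOneCocycles.pullback_apply, contOneCocycles.pullback_apply]
      exact ψ.apply_symm_apply (f.1 g)
  · -- (ii) real places with `w(Δ_W) > 0`, `d` not a square in `K_w`: the untwisting anti-commutes with `σ₀`
    obtain ⟨θ, -, hneg, -, hsquare⟩ := hloc w.Completion
    exact map_kummerLocalConditionAt_inf_eq_bot_of_neg_of_isReal W Wd hw hΔ hdsq φ θ hneg
      (fun t ↦ by rw [hφ]; exact hsquare t)

/-! ## §71 UP and the dichotomy for a FRAMED identification, modulo {PT, Tate χ} -/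

/-- **Cor. 3.4 (i) UP with a single REAL `T`-place for a FRAMED identification — kernel theorem modulo Poitou–Tate duality and Tate's χ
only; NO parity fact, NO image hypothesis.** Data as in file 21 (`φ, ψ` inverse intertwinings `Wd[2] ≅ W[2]` agreeing with the Kummer
conditions at split places; `w₀` real with `w₀(Δ_W) > 0`; the place menus; transversality at `w₀`), plus a FRAME DATUM `(π, A)` for
`φ`. If `Sel₂(W)` is strict at `w₀` then `#Sel₂(Wd) = #Sel₂(W) · 2`. The parity of the pair at `S = {w₀}` is part 9's
`GenusKolyKramer.isSquare_card_selmerGroup_mul_of_frame` (Kramer's congruence for framed identifications, all inputs proved).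
[cite: MazurRubin2010, Thm. 2.7, Prop. 3.3, Cor. 3.4 (i), Lemma 2.9] [cite: Kramer1981, §2 Prop. 6, Thm. 1] [cite: MilneADT2006, I Thm. 2.13, 4.10] -/
theorem natCard_selmerGroup_twist_eq_mul_two_of_places_inl_of_frame
    (hPT : poitouTate_selmerStructure_duality_real K)
    (hEP : ∀ v : HeightOneSpectrum (𝓞 K), localEulerPoincareCharacteristic (v.adicCompletion K))
    {Wd : WeierstrassCurve K} [Wd.IsElliptic] {d : K}
    (φ : (Wd.torsionGaloisModule ((2 : ℕ) : ℤ)).toContRepresentation →ⁱL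
      (W.torsionGaloisModule ((2 : ℕ) : ℤ)).toContRepresentation)
    (ψ : (W.torsionGaloisModule ((2 : ℕ) : ℤ)).toContRepresentation →ⁱL
      (Wd.torsionGaloisModule ((2 : ℕ) : ℤ)).toContRepresentation)
    (hψφ : ∀ a, ψ (φ a) = a) (hφψ : ∀ b, φ (ψ b) = b)
    (π : Fin 3 → Fin 3)
    (hπ : ∀ j, (show (Wd.torsionGaloisModule 2).toContRepresentation →ⁱL (W.torsionGaloisModule 2).toContRepresentation
      from φ) (T Wd (two_ne_zero (α := K)) j) = T W (two_ne_zero (α := K)) (π j))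
    (A : K) (hA : ∀ i j, xT Wd (two_ne_zero (α := K)) i - xT Wd (two_ne_zero (α := K)) j
      = algebraMap K (AlgebraicClosure K) A * (xT W (two_ne_zero (α := K)) (π i) - xT W (two_ne_zero (α := K)) (π j)))
    (hsplit : ∀ (E : Type) [Field E] [Algebra K E], (∃ s : E, s ^ 2 = algebraMap K E d) →
      (Wd.kummerLocalConditionAt ((2 : ℕ) : ℤ) E).map (galoisCohomology.map (φ.restrictField E) 1) =
        W.kummerLocalConditionAt ((2 : ℕ) : ℤ) E)
    {w₀ : InfinitePlace K} (hw₀ : w₀.IsReal) (hΔ : 0 < InfinitePlace.embedding_of_isReal hw₀ W.Δ)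
    (hfin : ∀ v : HeightOneSpectrum (𝓞 K),
      (∃ s : v.adicCompletion K, s ^ 2 = algebraMap K (v.adicCompletion K) d) ∨
      (((2 : ℕ) : 𝓞 K) ∉ v.asIdeal ∧ W.HasGoodReductionAt v ∧ Wd.HasGoodReductionAt v) ∨
      (((2 : ℕ) : 𝓞 K) ∉ v.asIdeal ∧
        Nat.card (nsmulAddMonoidHom 2 : (W.baseChange (v.adicCompletion K)).toAffine.Point →+ _).ker = 1 ∧
        Nat.card (nsmulAddMonoidHom 2 : (Wd.baseChange (v.adicCompletion K)).toAffine.Point →+ _).ker = 1))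
    (hinf : ∀ w : InfinitePlace K, w ≠ w₀ →
      (∃ s : w.Completion, s ^ 2 = algebraMap K w.Completion d) ∨
      ((∀ x : galoisCohomology (W.localGaloisModule w.Completion) 1, x = 0) ∧
        (∀ x : galoisCohomology (Wd.localGaloisModule w.Completion) 1, x = 0)))
    (htr : (Wd.kummerLocalConditionAt ((2 : ℕ) : ℤ) w₀.Completion).map
        (galoisCohomology.map (φ.restrictField w₀.Completion) 1) ⊓
      W.kummerLocalConditionAt ((2 : ℕ) : ℤ) w₀.Completion = ⊥)
    (hstrict : ∀ c ∈ (W.kummerSelmerStructure ((2 : ℕ) : ℤ)).selmerGroup,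
      galoisCohomology.localization (W.torsionGaloisModule ((2 : ℕ) : ℤ)) (Sum.inl w₀) 1 c = 0) :
    Nat.card (Wd.selmerGroup ((2 : ℕ) : ℤ)) = Nat.card (W.selmerGroup ((2 : ℕ) : ℤ)) * 2 := by
  haveI : Fact (Nat.Prime 2) := ⟨Nat.prime_two⟩
  let 𝓐 : SelmerStructure (W.torsionGaloisModule ((2 : ℕ) : ℤ)) := fun v ↦
    (Wd.kummerSelmerStructure ((2 : ℕ) : ℤ) v).map (galoisCohomology.map (φ.restrictField (Place.Completion v)) 1)
  have h𝓐 : ∀ v, 𝓐 v = (Wd.kummerSelmerStructure ((2 : ℕ) : ℤ) v).map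
      (galoisCohomology.map (φ.restrictField (Place.Completion v)) 1) := fun _ ↦ rfl
  have hagree := transport_twist_agree_off_inl W φ ψ hφψ hsplit 𝓐 h𝓐 w₀ hfin hinf
  have htr' : 𝓐 (Sum.inl w₀) ⊓ W.kummerSelmerStructure ((2 : ℕ) : ℤ) (Sum.inl w₀) = ⊥ := by
    rw [h𝓐, kummerSelmerStructure_apply, kummerSelmerStructure_apply]
    exact htr
  -- the parity of the pair at `S = {w₀}`: Kramer's congruence for the FRAMED identification `φ` (part 9, unconditional)
  have hpar : IsSquare (Nat.card (Wd.selmerGroup ((2 : ℕ) : ℤ)) * Nat.card (W.selmerGroup ((2 : ℕ) : ℤ)) *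
      (𝓐 (Sum.inl w₀)).relIndex (W.kummerSelmerStructure ((2 : ℕ) : ℤ) (Sum.inl w₀))) := by
    have hS : ∀ v ∉ ({(Sum.inl w₀ : Place K)} : Finset (Place K)), 𝓐 v = W.kummerSelmerStructure ((2 : ℕ) : ℤ) v :=
      fun v hv ↦ hagree v (by simpa using hv)
    have h := GenusKolyKramer.isSquare_card_selmerGroup_mul_of_frame W Wd φ (Function.LeftInverse.injective hψφ) π hπ A hA
      𝓐 h𝓐 {(Sum.inl w₀ : Place K)} hS
    rwa [Finset.prod_singleton] at h
  exact natCard_selmerGroup_eq_mul_of_transverse_inl_of_forall_localization_eq_zero W Wd 2 hPT hEP φ ψ hψφ hφψ 𝓐 h𝓐 w₀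
    hagree htr' (natCard_kummerSelmerStructure_inl_eq_two_of_isReal W hw₀ hΔ) hstrict hpar

/-- **The T-A DICHOTOMY with a single REAL `T`-place for a FRAMED identification** (UP or DOWN by exactly one `2`-dimension), modulo
{PT, Tate χ} only: `#Sel₂(Wd)·2 = #Sel₂(W)` (some Selmer class of `W` non-trivial at `w₀`) or `#Sel₂(Wd) = #Sel₂(W)·2` (`Sel₂(W)` strict
at `w₀`). [cite: MazurRubin2010, Thm. 2.7, Prop. 3.3, Cor. 3.4 (i)] [cite: Kramer1981, §2 Prop. 6, Thm. 1] -/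
theorem natCard_selmerGroup_twist_shift_of_places_inl_of_frame
    (hPT : poitouTate_selmerStructure_duality_real K)
    (hEP : ∀ v : HeightOneSpectrum (𝓞 K), localEulerPoincareCharacteristic (v.adicCompletion K))
    {Wd : WeierstrassCurve K} [Wd.IsElliptic] {d : K}
    (φ : (Wd.torsionGaloisModule ((2 : ℕ) : ℤ)).toContRepresentation →ⁱL
      (W.torsionGaloisModule ((2 : ℕ) : ℤ)).toContRepresentation)
    (ψ : (W.torsionGaloisModule ((2 : ℕ) : ℤ)).toContRepresentation →ⁱL
      (Wd.torsionGaloisModule ((2 : ℕ) : ℤ)).toContRepresentation)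
    (hψφ : ∀ a, ψ (φ a) = a) (hφψ : ∀ b, φ (ψ b) = b)
    (π : Fin 3 → Fin 3)
    (hπ : ∀ j, (show (Wd.torsionGaloisModule 2).toContRepresentation →ⁱL (W.torsionGaloisModule 2).toContRepresentation
      from φ) (T Wd (two_ne_zero (α := K)) j) = T W (two_ne_zero (α := K)) (π j))
    (A : K) (hA : ∀ i j, xT Wd (two_ne_zero (α := K)) i - xT Wd (two_ne_zero (α := K)) j
      = algebraMap K (AlgebraicClosure K) A * (xT W (two_ne_zero (α := K)) (π i) - xT W (two_ne_zero (α := K)) (π j)))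
    (hsplit : ∀ (E : Type) [Field E] [Algebra K E], (∃ s : E, s ^ 2 = algebraMap K E d) →
      (Wd.kummerLocalConditionAt ((2 : ℕ) : ℤ) E).map (galoisCohomology.map (φ.restrictField E) 1) =
        W.kummerLocalConditionAt ((2 : ℕ) : ℤ) E)
    {w₀ : InfinitePlace K} (hw₀ : w₀.IsReal) (hΔ : 0 < InfinitePlace.embedding_of_isReal hw₀ W.Δ)
    (hfin : ∀ v : HeightOneSpectrum (𝓞 K),
      (∃ s : v.adicCompletion K, s ^ 2 = algebraMap K (v.adicCompletion K) d) ∨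
      (((2 : ℕ) : 𝓞 K) ∉ v.asIdeal ∧ W.HasGoodReductionAt v ∧ Wd.HasGoodReductionAt v) ∨
      (((2 : ℕ) : 𝓞 K) ∉ v.asIdeal ∧
        Nat.card (nsmulAddMonoidHom 2 : (W.baseChange (v.adicCompletion K)).toAffine.Point →+ _).ker = 1 ∧
        Nat.card (nsmulAddMonoidHom 2 : (Wd.baseChange (v.adicCompletion K)).toAffine.Point →+ _).ker = 1))
    (hinf : ∀ w : InfinitePlace K, w ≠ w₀ →
      (∃ s : w.Completion, s ^ 2 = algebraMap K w.Completion d) ∨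
      ((∀ x : galoisCohomology (W.localGaloisModule w.Completion) 1, x = 0) ∧
        (∀ x : galoisCohomology (Wd.localGaloisModule w.Completion) 1, x = 0)))
    (htr : (Wd.kummerLocalConditionAt ((2 : ℕ) : ℤ) w₀.Completion).map
        (galoisCohomology.map (φ.restrictField w₀.Completion) 1) ⊓
      W.kummerLocalConditionAt ((2 : ℕ) : ℤ) w₀.Completion = ⊥) :
    Nat.card (Wd.selmerGroup ((2 : ℕ) : ℤ)) * 2 = Nat.card (W.selmerGroup ((2 : ℕ) : ℤ)) ∨
      Nat.card (Wd.selmerGroup ((2 : ℕ) : ℤ)) = Nat.card (W.selmerGroup ((2 : ℕ) : ℤ)) * 2 := by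
  by_cases hstrict : ∀ c ∈ (W.kummerSelmerStructure ((2 : ℕ) : ℤ)).selmerGroup,
      galoisCohomology.localization (W.torsionGaloisModule ((2 : ℕ) : ℤ)) (Sum.inl w₀) 1 c = 0
  · exact Or.inr (natCard_selmerGroup_twist_eq_mul_two_of_places_inl_of_frame W hPT hEP φ ψ hψφ hφψ π hπ A hA hsplit hw₀ hΔ
      hfin hinf htr hstrict)
  · push Not at hstrict
    obtain ⟨c, hc, hne⟩ := hstrict
    exact Or.inl (natCard_selmerGroup_twist_mul_two_eq_of_places_inl W hPT hEP φ ψ hψφ hφψ hsplit hw₀ hΔ hfin hinf htr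
      ⟨c, hc, hne⟩)

/-! ## §72 The dichotomy from the place menus alone — unconditional -/

/-- **Cor. 3.4 (i) / the T-A dichotomy with a single REAL `T`-place — UNCONDITIONAL kernel theorem.** `W/K` elliptic over a number
field, `Wd = C • W^{(d)}` elliptic, `w₀` a real place with `w₀(Δ_W) > 0` at which `d` is not a square, every finite place on the menu
{split | odd & good for both | odd & silent for both}, every other infinite place on the menu {split | `H¹ = 0` for both}: then
`#Sel₂(Wd)·2 = #Sel₂(W)` or `#Sel₂(Wd) = #Sel₂(W)·2`. Compared with gk2-p5's `natCard_selmerGroup_twist_shift_of_places_inl`: the named facts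
{PT, Tate χ, Kramer parity} are fed by tree theorems (`poitouTate_selmerStructure_duality_real_holds`, `localEulerPoincareCharacteristic_holds`,
part 9 for the framed canonical identification of §70) and the hypotheses `ρ̄_{W,2}` onto / `d ∉ K²` are GONE.
[cite: MazurRubin2010, Thm. 2.7, Lemma 2.9, Prop. 3.3, Cor. 3.4 (i)] [cite: Kramer1981, §2 Prop. 6, Thm. 1] [cite: MilneADT2006, I Thm. 2.8, 2.13, 4.10] -/
theorem natCard_selmerGroup_twist_shift_of_places_inl_frame
    {d : K} (hd : d ≠ 0) {Wd : WeierstrassCurve K} [Wd.IsElliptic] {C : VariableChange K}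
    (hWd : C • W.quadraticTwist d = Wd)
    {w₀ : InfinitePlace K} (hw₀ : w₀.IsReal) (hΔ : 0 < InfinitePlace.embedding_of_isReal hw₀ W.Δ)
    (hdsq₀ : ∀ s : w₀.Completion, s ^ 2 ≠ algebraMap K w₀.Completion d)
    (hfin : ∀ v : HeightOneSpectrum (𝓞 K),
      (∃ s : v.adicCompletion K, s ^ 2 = algebraMap K (v.adicCompletion K) d) ∨
      (((2 : ℕ) : 𝓞 K) ∉ v.asIdeal ∧ W.HasGoodReductionAt v ∧ Wd.HasGoodReductionAt v) ∨
      (((2 : ℕ) : 𝓞 K) ∉ v.asIdeal ∧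
        Nat.card (nsmulAddMonoidHom 2 : (W.baseChange (v.adicCompletion K)).toAffine.Point →+ _).ker = 1 ∧
        Nat.card (nsmulAddMonoidHom 2 : (Wd.baseChange (v.adicCompletion K)).toAffine.Point →+ _).ker = 1))
    (hinf : ∀ w : InfinitePlace K, w ≠ w₀ →
      (∃ s : w.Completion, s ^ 2 = algebraMap K w.Completion d) ∨
      ((∀ x : galoisCohomology (W.localGaloisModule w.Completion) 1, x = 0) ∧
        (∀ x : galoisCohomology (Wd.localGaloisModule w.Completion) 1, x = 0))) :
    Nat.card (Wd.selmerGroup ((2 : ℕ) : ℤ)) * 2 = Nat.card (W.selmerGroup ((2 : ℕ) : ℤ)) ∨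
      Nat.card (Wd.selmerGroup ((2 : ℕ) : ℤ)) = Nat.card (W.selmerGroup ((2 : ℕ) : ℤ)) * 2 := by
  have hEP : ∀ v : HeightOneSpectrum (𝓞 K), localEulerPoincareCharacteristic (v.adicCompletion K) := fun v ↦
    haveI : CharZero (v.adicCompletion K) := charZero_of_injective_algebraMap (algebraMap K _).injective
    localEulerPoincareCharacteristic_holds (v.adicCompletion K)
  obtain ⟨φ, ψ, hψφ, hφψ, hsplit, hreal, π, A, hπ, hA⟩ := exists_intertwining_hsplit_and_transverse_inl_frame W hd hWd
  exact natCard_selmerGroup_twist_shift_of_places_inl_of_frame W (poitouTate_selmerStructure_duality_real_holds (K := K)) hEP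
    φ ψ hψφ hφψ π hπ A hA hsplit hw₀ hΔ hfin hinf (hreal w₀ hw₀ hΔ hdsq₀)

end Summit.BirchSwinnertonDyer.BirchSwinnertonDyer.Theorems.GenusKolyArch

end
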